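import Literature.NumberTheory.LFunctions.WeilMarkovThreePrime
import Literature.NumberTheory.LFunctions.KadiriNumericsBase
import Literature.ComputerArithmetic.BrisebarreHanrotMullerZimmermann2025.ExactCases
import Mathlib.Topology.Instances.AddCircle.DenseSubgroup
import HarnessLib

/-!
# rh-explicit (venture WeilGRH): THE PHASE-LOCKED PRIME SUM OF A `{2,3,4}`-WINDOW ATTAINS ITS BOUND AT ARBITRARILY
  LARGE HEIGHTS — `sup_{τ ≥ T} (−2Σ_{n=2,3,4} c_n cos(τ log n)) = 2(c₂ + c₃ − c₄)` for every `T` (Kronecker)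

Cell `rh-explicit`, WEIL TRACK (structure seat weil-3, gen11).  RH-free; no measure, no zeros.  Companion of the
phase-locked window certificate (`ZetaLowZerosSimple.neg_two_mul_cos_flatSum_frontier_le`: for the frontier window
`a₀ = 4023/5000`, `−2Σ_{n∈{2,3,4}}Λ(n)n^{-1/2}(1 − log n/2a₀)cos(τ log n) ≤ 2(c₂ + c₃ − c₄) ≤ 0.8646` for EVERY `τ`,
using only `cos(τ log 4) = 2cos²(τ log 2) − 1`).  Here the converse: that bound is the supremum over every
half-line of heights, so the phase-free certification radius of the window (`|τ| ≤ 62.5`) cannot be pushed by any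
finer analysis that does not evaluate the phases.

* `irrational_log_two_div_log_three`: `log 2/log 3 ∉ ℚ` (`3` is not an integer power of `2`;
  `BrisebarreHanrotMullerZimmermann2025.irrational_logb_two_ratCast`);
* `exists_phases_near_worst` (Kronecker in dimension one, `AddCircle`/`dense_addSubgroupClosure_pair_iff`): for every
  `δ > 0` and `T` there is `τ ≥ T` with `cos(τ log 3) = −1`, `cos(τ log 2) ≤ −1 + δ`, `cos(2τ log 2) ≥ 1 − 2δ`
  (`τ = |2m+1|π/log 3` with `m ∈ Nℤ ∖ {0}`, `(2m+1)·(log 2/log 3)/2` within `δ/2π` of `½ mod 1`);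
* **`exists_neg_cos_flatSum_threePrime_ge`**: for `log 2 < a ≤ (log 5)/2`, every `ε > 0` and every `T` there is
  `τ ≥ T` with `−2Σ_{n∈weilPrimeIndex a}Λ(n)n^{-1/2}(1 − log n/2a)cos(τ log n) ≥ 2(c₂(a) + c₃(a) − c₄(a)) − ε`,
  `c_n(a) = Λ(n)n^{-1/2}(1 − log n/2a)`;
* **`exists_neg_cos_flatSum_frontier_ge`**: at `a₀ = 4023/5000`, `≥ 0.8645 − ε` at arbitrarily large heights (the
  everywhere-bound is `0.8646`): the phase-locked constant is optimal to `10⁻⁴`.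

No definitions, no named facts; RH-free.
-/

set_option autoImplicit false

noncomputable section

open Filter Set
open scoped Real Topology ArithmeticFunction.vonMangoldt

namespace Summit.Ventures.WeilGRH

open Literature.NumberTheory.LFunctions

/-! ## `log 2 / log 3` is irrational -/

/-- `3` is not an integer power of `2` (in `ℚ`). -/
private theorem three_ne_two_zpow (k : ℤ) : (3 : ℚ) ≠ 2 ^ k := by
  intro hk
  rcases le_or_gt k 0 with h | h
  · have : (2 : ℚ) ^ k ≤ 1 := zpow_le_one_of_nonpos₀ (by norm_num) h
    linarith
  · obtain ⟨n, rfl⟩ : ∃ n : ℕ, k = n := ⟨k.toNat, (Int.toNat_of_nonneg h.le).symm⟩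
    rw [zpow_natCast] at hk
    have hn : 1 ≤ n := by exact_mod_cast h
    rcases eq_or_lt_of_le hn with rfl | hn2
    · norm_num at hk
    · have : (2 : ℚ) ^ 2 ≤ 2 ^ n := pow_le_pow_right₀ (by norm_num) hn2
      linarith

/-- **`log 2 / log 3` is irrational** (`2^q = 3^p` is impossible for `q ≥ 1`). -/
theorem irrational_log_two_div_log_three : Irrational (Real.log 2 / Real.log 3) := by
  have h := Literature.ComputerArithmetic.BrisebarreHanrotMullerZimmermann2025.irrational_logb_two_ratCast
    (x := 3) (by norm_num) three_ne_two_zpow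
  rw [Real.logb] at h
  push_cast at h
  have : Real.log 2 / Real.log 3 = (Real.log 3 / Real.log 2)⁻¹ := by rw [inv_div]
  rw [this]
  exact irrational_inv_iff.2 h

/-! ## Kronecker: the phases of `2` and `3` come jointly as close as desired to `(π, π)` at large heights -/

/-- `0.63 < log 2/log 3 < 0.632`. -/
private theorem log_two_div_log_three_mem :
    (0.63 : ℝ) < Real.log 2 / Real.log 3 ∧ Real.log 2 / Real.log 3 < 0.632 := by
  have hl2 := Real.log_two_gt_d9
  have hl2' := Real.log_two_lt_d9
  obtain ⟨hl3, hl3'⟩ := KadiriNumerics.log_3_bounds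
  have h3 : 0 < Real.log 3 := by linarith
  constructor
  · rw [lt_div_iff₀ h3]; linarith
  · rw [div_lt_iff₀ h3]; linarith

/-- **The phases near the worst case, at arbitrarily large heights**: for every `δ > 0` and every `T` there is
`τ ≥ T` with `cos(τ log 3) = −1`, `cos(τ log 2) ≤ −1 + δ` and `1 − 2δ ≤ cos(2τ log 2)`. -/
theorem exists_phases_near_worst {δ : ℝ} (hδ : 0 < δ) (T : ℝ) :
    ∃ τ : ℝ, T ≤ τ ∧ Real.cos (τ * Real.log 3) = -1 ∧ Real.cos (τ * Real.log 2) ≤ -1 + δ ∧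
      1 - 2 * δ ≤ Real.cos (2 * (τ * Real.log 2)) := by
  set x : ℝ := Real.log 2 / Real.log 3 with hx
  obtain ⟨hx1, hx2⟩ := log_two_div_log_three_mem
  obtain ⟨hl3, hl3'⟩ := KadiriNumerics.log_3_bounds
  have hl3pos : 0 < Real.log 3 := by linarith
  have hpi := Real.pi_gt_three
  have hpi' := Real.pi_lt_d2
  -- the multiplier `N` forcing `|m| ≥ N`
  set N : ℕ := ⌈|T|⌉₊ + 1 with hN
  have hN1 : (1 : ℝ) ≤ N := by
    have : (1 : ℕ) ≤ N := by rw [hN]; exact Nat.le_add_left 1 _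
    exact_mod_cast this
  have hNT : |T| ≤ (N : ℝ) - 1 := by
    have h1 : |T| ≤ (⌈|T|⌉₊ : ℝ) := Nat.le_ceil _
    have h2 : (N : ℝ) = (⌈|T|⌉₊ : ℝ) + 1 := by rw [hN]; push_cast; ring
    linarith
  -- density of `ℤ·(2πNx) + ℤ·2π` in `ℝ`
  have hirr : Irrational ((N : ℝ) * (2 * π * x) / (2 * π)) := by
    rw [show (N : ℝ) * (2 * π * x) / (2 * π) = (N : ℕ) * x by field_simp]
    exact irrational_log_two_div_log_three.natCast_mul (by rw [hN]; omega)
  have hdense := dense_addSubgroupClosure_pair_iff.2 hirr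
  -- a point of the subgroup within `δ' = min δ (1/2)` of `π − πx`
  set δ' : ℝ := min δ (1 / 2) with hδ'
  have hδ'0 : 0 < δ' := lt_min hδ (by norm_num)
  have hδ'1 : δ' ≤ δ := min_le_left _ _
  have hδ'2 : δ' ≤ 1 / 2 := min_le_right _ _
  obtain ⟨s, hsmem, hsdist⟩ : ∃ s ∈ (AddSubgroup.closure {(N : ℝ) * (2 * π * x), 2 * π} : Set ℝ),
      dist s (π - π * x) < δ' := by
    have := Metric.dense_iff.1 hdense (π - π * x) δ' hδ'0
    obtain ⟨s, hs1, hs2⟩ := this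
    exact ⟨s, hs2, Metric.mem_ball.1 hs1⟩
  obtain ⟨m', k, hmk⟩ := AddSubgroup.mem_closure_pair.1 hsmem
  rw [Real.dist_eq] at hsdist
  -- `m' ≠ 0`: otherwise `2πk` would be within `1/2` of `π − πx ∈ (1.15, 1.17)`
  have hm' : m' ≠ 0 := by
    intro h0
    rw [h0, zero_zsmul, zero_add] at hmk
    rw [← hmk, zsmul_eq_mul] at hsdist
    have hlt := (abs_lt.1 hsdist)
    rcases lt_trichotomy k 0 with hk | hk | hk
    · have : (k : ℝ) ≤ -1 := by exact_mod_cast Int.le_sub_one_of_lt hk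
      nlinarith [hlt.1, hlt.2]
    · rw [hk] at hlt; push_cast at hlt; nlinarith [hlt.1, hlt.2]
    · have : (1 : ℝ) ≤ k := by exact_mod_cast hk
      nlinarith [hlt.1, hlt.2]
  -- the height
  set m : ℤ := (N : ℤ) * m' with hm
  set θ : ℝ := (2 * m + 1) * π * x with hθ
  have hθs : θ = s - 2 * π * k + π * x := by
    rw [hθ, ← hmk, hm, zsmul_eq_mul, zsmul_eq_mul]; push_cast; ring
  -- `cos θ ≤ −1 + δ`, `cos 2θ ≥ 1 − 2δ`
  have hθnear : |θ - (π + (-k : ℤ) * (2 * π))| < δ' := by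
    rw [hθs]; push_cast
    have : s - 2 * π * k + π * x - (π + -(k : ℝ) * (2 * π)) = s - (π - π * x) := by ring
    rw [this]; exact hsdist
  have hcosθ : Real.cos θ ≤ -1 + δ := by
    have h1 := Real.abs_cos_sub_cos_le θ (π + (-k : ℤ) * (2 * π))
    rw [Real.cos_add_int_mul_two_pi, Real.cos_pi] at h1
    have h2 := (abs_le.1 (h1.trans hθnear.le)).2
    linarith
  have hcos2θ : 1 - 2 * δ ≤ Real.cos (2 * θ) := by
    have h1 := Real.abs_cos_sub_cos_le (2 * θ) (2 * π + (-(2 * k) : ℤ) * (2 * π))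
    rw [Real.cos_add_int_mul_two_pi, Real.cos_two_pi] at h1
    have h3 : |2 * θ - (2 * π + ((-(2 * k) : ℤ) : ℝ) * (2 * π))| < 2 * δ' := by
      have : 2 * θ - (2 * π + ((-(2 * k) : ℤ) : ℝ) * (2 * π)) = 2 * (θ - (π + ((-k : ℤ) : ℝ) * (2 * π))) := by
        push_cast; ring
      rw [this, abs_mul, abs_two]
      linarith
    have h2 := (abs_le.1 (h1.trans h3.le)).1
    linarith
  -- τ := |2m+1| π / log 3
  refine ⟨|2 * (m : ℝ) + 1| * π / Real.log 3, ?_, ?_, ?_, ?_⟩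
  · -- T ≤ τ: |2m+1| ≥ 2N − 1 and π/log 3 > 1
    have hmabs : (N : ℝ) ≤ |(m : ℝ)| := by
      rw [hm]; push_cast
      rw [abs_mul, Nat.abs_cast]
      have : (1 : ℝ) ≤ |(m' : ℝ)| := by
        rw [← Int.cast_abs]; exact_mod_cast Int.one_le_abs hm'
      nlinarith
    have h2m : 2 * (N : ℝ) - 1 ≤ |2 * (m : ℝ) + 1| := by
      have := abs_sub_abs_le_abs_sub (2 * (m : ℝ)) (-1)
      rw [sub_neg_eq_add, abs_neg, abs_one, abs_mul, abs_two] at this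
      linarith
    have hT : T ≤ |T| := le_abs_self T
    have hTl : T * Real.log 3 ≤ |T| * 1.0986122887 :=
      (mul_le_mul_of_nonneg_right hT hl3pos.le).trans (mul_le_mul_of_nonneg_left hl3' (abs_nonneg T))
    have hprod : (2 * (N : ℝ) - 1) * 3 ≤ |2 * (m : ℝ) + 1| * π :=
      mul_le_mul h2m hpi.le (by norm_num) (abs_nonneg _)
    rw [le_div_iff₀ hl3pos]
    nlinarith [abs_nonneg T]
  · -- cos(τ log 3) = cos(|2m+1| π) = −1
    rw [div_mul_cancel₀ _ hl3pos.ne']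
    rcases abs_choice (2 * (m : ℝ) + 1) with h | h <;> rw [h]
    · rw [show (2 * (m : ℝ) + 1) * π = π + (m : ℤ) * (2 * π) by ring,
        Real.cos_add_int_mul_two_pi, Real.cos_pi]
    · rw [show -(2 * (m : ℝ) + 1) * π = π + ((-(m + 1) : ℤ) : ℝ) * (2 * π) by push_cast; ring,
        Real.cos_add_int_mul_two_pi, Real.cos_pi]
  · -- cos(τ log 2) = cos(|θ|) = cos θ
    have : |2 * (m : ℝ) + 1| * π / Real.log 3 * Real.log 2 = |θ| := by
      rw [hθ, abs_mul, abs_mul, abs_of_pos Real.pi_pos, abs_of_pos (by linarith : (0 : ℝ) < x), hx]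
      field_simp
    rw [this, Real.cos_abs]
    exact hcosθ
  · have : 2 * (|2 * (m : ℝ) + 1| * π / Real.log 3 * Real.log 2) = |2 * θ| := by
      rw [hθ, abs_mul, abs_mul, abs_mul, abs_two, abs_of_pos Real.pi_pos, abs_of_pos (by linarith : (0 : ℝ) < x),
        hx]
      field_simp
    rw [this, Real.cos_abs]
    exact hcos2θ

/-! ## The supremum of the phase-locked prime sum -/

/-- **THE PHASE-LOCKED BOUND IS ATTAINED AT ARBITRARILY LARGE HEIGHTS** (`{2,3,4}`-window `log 2 < a ≤ (log 5)/2`):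
for every `ε > 0` and every `T` there is `τ ≥ T` with

  `−2Σ_{n∈weilPrimeIndex a} Λ(n)n^{-1/2}(1 − log n/2a) cos(τ log n) ≥ 2(c₂ + c₃ − c₄) − ε`,

`c₂ = (log 2/√2)(1 − log 2/2a)`, `c₃ = (log 3/√3)(1 − log 3/2a)`, `c₄ = ((log 2)/2)(1 − log 4/2a)`. -/
theorem exists_neg_cos_flatSum_threePrime_ge {a : ℝ} (ha : Real.log 2 < a) (ha' : a ≤ Real.log 5 / 2) {ε : ℝ}
    (hε : 0 < ε) (T : ℝ) :
    ∃ τ : ℝ, T ≤ τ ∧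
      2 * (Real.log 2 / Real.sqrt 2 * (1 - Real.log 2 / (2 * a)) +
            Real.log 3 / Real.sqrt 3 * (1 - Real.log 3 / (2 * a)) -
            Real.log 2 / 2 * (1 - Real.log 4 / (2 * a))) - ε ≤
        -(2 * ∑ n ∈ weilPrimeIndex a, (Λ n : ℝ) / Real.sqrt n *
          ((1 - Real.log n / (2 * a)) * Real.cos (τ * Real.log n))) := by
  have hl2 := Real.log_two_gt_d9
  have ha0 : 0 < a := by linarith
  -- the coefficients `c₂, c₄ ≥ 0`
  have hc2 : 0 ≤ Real.log 2 / Real.sqrt 2 * (1 - Real.log 2 / (2 * a)) := by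
    refine mul_nonneg (div_nonneg (by linarith) (Real.sqrt_nonneg _)) ?_
    rw [sub_nonneg, div_le_one (by linarith)]; linarith
  have hlog4 : Real.log 4 = 2 * Real.log 2 := by
    rw [show (4 : ℝ) = 2 ^ 2 by norm_num, Real.log_pow]; norm_num
  have hc4 : 0 ≤ Real.log 2 / 2 * (1 - Real.log 4 / (2 * a)) := by
    refine mul_nonneg (by linarith) ?_
    rw [sub_nonneg, div_le_one (by linarith), hlog4]; linarith
  set c₂ : ℝ := Real.log 2 / Real.sqrt 2 * (1 - Real.log 2 / (2 * a)) with hc₂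
  set c₃ : ℝ := Real.log 3 / Real.sqrt 3 * (1 - Real.log 3 / (2 * a)) with hc₃
  set c₄ : ℝ := Real.log 2 / 2 * (1 - Real.log 4 / (2 * a)) with hc₄
  -- phases within `δ = ε/(2c₂ + 4c₄ + 1)` of the worst case
  set δ : ℝ := ε / (2 * c₂ + 4 * c₄ + 1) with hδ
  have hD : 0 < 2 * c₂ + 4 * c₄ + 1 := by positivity
  have hδ0 : 0 < δ := div_pos hε hD
  obtain ⟨τ, hT, h3, h2, h4⟩ := exists_phases_near_worst hδ0 T
  refine ⟨τ, hT, ?_⟩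
  rw [sum_weilPrimeIndex_eq_threePrime ha ha']
  push_cast
  rw [show τ * Real.log 4 = 2 * (τ * Real.log 2) by rw [hlog4]; ring, h3]
  have hεδ : δ * (2 * c₂ + 4 * c₄ + 1) = ε := by rw [hδ]; field_simp
  have e : -(2 * (Real.log 2 / Real.sqrt 2 * ((1 - Real.log 2 / (2 * a)) * Real.cos (τ * Real.log 2)) +
        Real.log 3 / Real.sqrt 3 * ((1 - Real.log 3 / (2 * a)) * -1) +
        Real.log 2 / 2 * ((1 - Real.log 4 / (2 * a)) * Real.cos (2 * (τ * Real.log 2))))) =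
      -2 * (c₂ * Real.cos (τ * Real.log 2)) + 2 * c₃ - 2 * (c₄ * Real.cos (2 * (τ * Real.log 2))) := by
    rw [hc₂, hc₃, hc₄]; ring
  rw [e]
  have k1 : c₂ * Real.cos (τ * Real.log 2) ≤ c₂ * (-1 + δ) := mul_le_mul_of_nonneg_left h2 hc2
  have k2 : c₄ * Real.cos (2 * (τ * Real.log 2)) ≤ c₄ * 1 := mul_le_mul_of_nonneg_left (Real.cos_le_one _) hc4
  nlinarith

/-- **At the frontier rung**: for every `ε > 0` and `T` there is `τ ≥ T` with
`−2Σ_{n∈{2,3,4}} Λ(n)n^{-1/2}(1 − log n/2a₀) cos(τ log n) ≥ 0.8645 − ε` (`a₀ = 4023/5000`; the bound valid at every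
`τ` is `0.8646`, `ZetaLowZerosSimple.neg_two_mul_cos_flatSum_frontier_le`): the phase-locked constant is optimal. -/
theorem exists_neg_cos_flatSum_frontier_ge {ε : ℝ} (hε : 0 < ε) (T : ℝ) :
    ∃ τ : ℝ, T ≤ τ ∧ 0.8645 - ε ≤
      -(2 * ∑ n ∈ weilPrimeIndex (4023 / 5000 : ℝ), (Λ n : ℝ) / Real.sqrt n *
        ((1 - Real.log n / (2 * (4023 / 5000 : ℝ))) * Real.cos (τ * Real.log n))) := by
  have hl2 := Real.log_two_gt_d9
  have hl2' := Real.log_two_lt_d9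
  obtain ⟨hl3, hl3'⟩ := KadiriNumerics.log_3_bounds
  obtain ⟨hl5, -⟩ := KadiriNumerics.log_5_bounds
  have ha : Real.log 2 < 4023 / 5000 := by linarith
  have ha' : (4023 / 5000 : ℝ) ≤ Real.log 5 / 2 := by linarith
  obtain ⟨τ, hT, h⟩ := exists_neg_cos_flatSum_threePrime_ge ha ha' hε T
  refine ⟨τ, hT, le_trans ?_ h⟩
  -- `2(c₂ + c₃ − c₄) ≥ 0.8645`
  have hlog4 : Real.log 4 = 2 * Real.log 2 := by
    rw [show (4 : ℝ) = 2 ^ 2 by norm_num, Real.log_pow]; norm_num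
  rw [hlog4]
  have hs2' : Real.sqrt 2 ≤ 1.41421357 := by
    rw [show (1.41421357 : ℝ) = Real.sqrt (1.41421357 ^ 2) by rw [Real.sqrt_sq (by norm_num)]]
    exact Real.sqrt_le_sqrt (by norm_num)
  have hs3' : Real.sqrt 3 ≤ 1.7320509 := by
    rw [show (1.7320509 : ℝ) = Real.sqrt (1.7320509 ^ 2) by rw [Real.sqrt_sq (by norm_num)]]
    exact Real.sqrt_le_sqrt (by norm_num)
  have hs2 : (1.41421356 : ℝ) ≤ Real.sqrt 2 := Real.le_sqrt_of_sq_le (by norm_num)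
  have hs3 : (1.7320508 : ℝ) ≤ Real.sqrt 3 := Real.le_sqrt_of_sq_le (by norm_num)
  have hs2pos : (0 : ℝ) < Real.sqrt 2 := by linarith
  have hs3pos : (0 : ℝ) < Real.sqrt 3 := by linarith
  have hA1lo : 0.490129 ≤ Real.log 2 / Real.sqrt 2 := by rw [le_div_iff₀ hs2pos]; nlinarith
  have hB1lo : 0.569259 ≤ 1 - Real.log 2 / (2 * (4023 / 5000 : ℝ)) := by
    have key : Real.log 2 / (2 * (4023 / 5000)) ≤ (0.430741 : ℝ) := by
      rw [div_le_iff₀ (by norm_num)]; norm_num; linarith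
    linarith
  have hA2lo : 0.634284 ≤ Real.log 3 / Real.sqrt 3 := by rw [le_div_iff₀ hs3pos]; nlinarith
  have hB2lo : 0.317292 ≤ 1 - Real.log 3 / (2 * (4023 / 5000 : ℝ)) := by
    have key : Real.log 3 / (2 * (4023 / 5000)) ≤ (0.682708 : ℝ) := by
      rw [div_le_iff₀ (by norm_num)]; norm_num; linarith
    linarith
  have hA3 : Real.log 2 / 2 ≤ 0.3465736 := by linarith
  have hB3 : 1 - 2 * Real.log 2 / (2 * (4023 / 5000 : ℝ)) ≤ 0.13852 := by
    have key : (0.86148 : ℝ) ≤ 2 * Real.log 2 / (2 * (4023 / 5000)) := by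
      rw [le_div_iff₀ (by norm_num)]; norm_num; linarith
    linarith
  have hB3' : 0 ≤ 1 - 2 * Real.log 2 / (2 * (4023 / 5000 : ℝ)) := by
    rw [sub_nonneg, div_le_one (by norm_num)]; linarith
  have hc2 := mul_le_mul hA1lo hB1lo (by norm_num) (by positivity)
  have hc3 := mul_le_mul hA2lo hB2lo (by norm_num) (by positivity)
  have hc4 := mul_le_mul hA3 hB3 hB3' (by norm_num)
  norm_num at hc2 hc3 hc4 ⊢
  linarith

end Summit.Ventures.WeilGRH

end
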